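import Summits.BirchSwinnertonDyer.BirchSwinnertonDyer.Theorems.SylvesterTwoHeegnerIndexLowerHalfTwoRankFourMembers
import Summits.BirchSwinnertonDyer.BirchSwinnertonDyer.Theorems.SylvesterTwoHeegnerIndexLowerHalfFourTorsionMembersC
import HarnessLib

/-!
# Route `SylvesterTwoHeegnerIndex` (rung K7t), LOWER child `LowerOffV0HSY` (item 19892): the row type
# `Ш(E_p)[2] ≅ (ℤ/2)⁴` with `Ш[4] ≠ Ш[2]` — `64 ∣ #Ш` from a `2`-descent, and the member `p = 831631`
# (helper toward stmt-BirchSwinnertonDyer-19892; cell «bsd-cm», seat `bsd-cm-k7t-c3` g7; theorems only)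

HONEST FRAMING (cell «bsd-cm»; FULL-BSD RANK ≤ 1 programme): 𝒞_HSY at `p = 2` is OPEN in print and stays
open here. THEOREMS ONLY (0 definitions, 0 named facts, 0 `sorry`); member conclusions are CONDITIONAL
on `PublishedFactsTwo` and on DISPLAYED PER-CURVE CERTIFICATE DATA NOT proved in the kernel.

Sequel to `…LowerHalfTwoRankFourMembers` (the `[1,1,4]` rows, where the descent pins
`Ш[2^∞] = Ш[2]`). Among the 78 members `p ≤ 10⁷` with `dim_𝔽₂ Sel₂(E_p/ℚ) = 5` (seat-g7 census,
kit j269192 / j269338), three have PARI `ellrank` type `[1, 3, 2]`: `dim Ш(E_p)[2] = 4` but the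
Cassels–Tate pairing on `Sel₂` has rank `2` only, i.e. `dim (Ш[2] ∩ 2·Ш) = 2` — a Klein four-group
of `Ш[2]` consists of doubles. §1 proves the group-theoretic count this feeds:
**`#G[2] = 16` and a Klein four `{0, x, y, x+y} ⊆ G[2]` with halves `2x′ = x`, `2y′ = y` force
`64 ∣ #G`** (the doubling map `G[4] → G[2]` has kernel `G[2]` and image `⊇ {0, x, y, x+y}`, so
`#G[4] = 16 · #(2·G[4])` with `4 ∣ #(2·G[4])`). §2 turns it into the LOWER consumer at such a member
(`ord₂ #Ш_an ≤ 6 ≤ ord₂ #Ш(W)`) and records what `BSD(E_p, 2)` then amounts to (`¬ 2⁷ ∣ #Ш(W)`,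
i.e. `Ш[8] = Ш[4]`: an `8`-descent / Cassels–Tate-on-`Sel₄` question). §3 displays the first such
member, `p = 831631` (`#Ш_an = 64` single-engine, kit j269511; BSD₂ predicts
`Ш(E_{831631})[2^∞] ≅ (ℤ/4)² ⊕ (ℤ/2)²`).

PARTITION (D-0054): CornerF at `2` / O12 × 𝒞_HSY members with `dim Ш(E_p)[2] = 4`, `Ш[4] ≠ Ш[2]`
(per member) × `p = 2` — per-pair certificate consumers; closes no cell and no class; nothing booked.
NOT a proof of the crux, of `BSD(E_p, 2)` for any `p` as an unconditional kernel theorem, or of any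
cell. References (locators only): [HuShuYin2019] Thm. 1.3/1.4 (p. 3); [BurungaleFlach2024] Thm. 1.1,
Cor. 2; [Miller2011LMS] §1, Def. 1.1; [Cremona1997] §3.6; Cassels, J. reine angew. Math. 211 (1962)
95–112 (the pairing; kernel on `Ш[2]` = `Ш[2] ∩ 2Ш`); [KezukaLi2020] Thm. 1.3.
-/

set_option autoImplicit false
-- the Theorems namespace `Summit.BirchSwinnertonDyer.BirchSwinnertonDyer.…` repeats a component by design (D-0017 layout)
set_option linter.dupNamespace false

noncomputable section

open scoped Classical

open WeierstrassCurve NumberField Literature.NumberTheory.EllipticCurves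
  Literature.NumberTheory.EllipticCurves.ModularForms
  Literature.NumberTheory.EllipticCurves.Rank1Residual
  Literature.NumberTheory.EllipticCurves.Rank1Residual.Typed
  Literature.NumberTheory.EllipticCurves.HuShuYin2019
  Summit.BirchSwinnertonDyer.Rank1Residual.P2
  Summit.BirchSwinnertonDyer.Rank1Residual.X12.Sylvester
  Summit.BirchSwinnertonDyer.BirchSwinnertonDyer.Theses.SylvesterTwoHeegnerIndex

namespace Summit.BirchSwinnertonDyer.BirchSwinnertonDyer.Theorems

namespace SylvesterTwoLowerCert

/-! ## §1 `#G[2] = 16` and a Klein four of doubles force `64 ∣ #G` -/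

section GroupTheory

variable {G : Type*} [AddCommGroup G]

/-- **`#G[2] = 16` plus a Klein four-group `{0, x, y, x + y} ⊆ G[2]` whose generators are doubles
(`2 • x′ = x`, `2 • y′ = y`) force `64 ∣ #G`** (`Nat.card`; junk `64 ∣ 0` for infinite `G`): the
doubling map `G[4] → G`, `z ↦ 2z`, has kernel `G[2]` (order `16`) and its range contains the Klein
four `{0, x, y, x + y}` (so `4 ∣ #range`), whence `64 ∣ #G[4] ∣ #G`. [folklore] -/
theorem sixtyfour_dvd_card_of_card_twoTorsion_of_kleinFour_halves
    (h16 : Nat.card (AddSubgroup.torsionBy G (2 : ℕ)) = 16)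
    {x y x' y' : G} (hx : (2 : ℤ) • x = 0) (hy : (2 : ℤ) • y = 0) (hx0 : x ≠ 0) (hy0 : y ≠ 0)
    (hxy : x ≠ y) (hx' : (2 : ℤ) • x' = x) (hy' : (2 : ℤ) • y' = y) : 64 ∣ Nat.card G := by
  have z2 : ∀ z : G, (2 : ℤ) • z = (2 : ℕ) • z := fun z => by
    have := natCast_zsmul z 2; push_cast at this; exact this
  set T4 : AddSubgroup G := AddSubgroup.torsionBy G (4 : ℕ) with hT4
  let f : T4 →+ G := (DistribSMul.toAddMonoidHom G (2 : ℕ)).comp T4.subtype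
  have hf : ∀ z : T4, f z = (2 : ℕ) • (z : G) := fun z => rfl
  -- a half of a `2`-torsion element lies in `G[4]`
  have memT4 : ∀ {w v : G}, (2 : ℤ) • w = v → (2 : ℤ) • v = 0 → w ∈ T4 := by
    intro w v hw hv
    rw [hT4, AddSubgroup.torsionBy.nsmul_iff, show (4 : ℕ) = 2 * 2 by rfl, mul_smul, ← z2, ← z2, hw, hv]
  -- the kernel of the doubling map is (in bijection with) `G[2]`
  have hker : Nat.card f.ker = 16 := by
    rw [← h16]
    refine Nat.card_congr
      { toFun := fun z => ⟨((z : T4) : G), by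
          rw [AddSubgroup.torsionBy.nsmul_iff, ← hf]; exact (AddMonoidHom.mem_ker).1 z.2⟩
        invFun := fun t => ⟨⟨(t : G), by
            rw [hT4, AddSubgroup.torsionBy.nsmul_iff, show (4 : ℕ) = 2 * 2 by rfl, mul_smul,
              AddSubgroup.torsionBy.nsmul_iff.1 t.2, smul_zero]⟩,
          by rw [AddMonoidHom.mem_ker, hf]; exact AddSubgroup.torsionBy.nsmul_iff.1 t.2⟩
        left_inv := fun z => by ext; rfl
        right_inv := fun t => by ext; rfl }
  -- `#G[4] = #range · #ker`
  have hprod : Nat.card T4 = Nat.card f.range * Nat.card f.ker := by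
    rw [AddSubgroup.card_eq_card_quotient_mul_card_addSubgroup f.ker,
      Nat.card_congr (QuotientAddGroup.quotientKerEquivRange f).toEquiv]
  -- the Klein four `{0, x, y, x + y}` lies in the range
  have hxr : x ∈ f.range := ⟨⟨x', memT4 hx' hx⟩, by rw [hf, ← z2]; exact hx'⟩
  have hyr : y ∈ f.range := ⟨⟨y', memT4 hy' hy⟩, by rw [hf, ← z2]; exact hy'⟩
  have h4 : 4 ∣ Nat.card f.range := by
    refine four_dvd_card_of_kleinFour (G := f.range) (x := ⟨x, hxr⟩) (y := ⟨y, hyr⟩) ?_ ?_ ?_ ?_ ?_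
    · exact Subtype.ext (by simpa using hx)
    · exact Subtype.ext (by simpa using hy)
    · exact fun h => hx0 (congrArg Subtype.val h)
    · exact fun h => hy0 (congrArg Subtype.val h)
    · exact fun h => hxy (congrArg Subtype.val h)
  have h64 : 64 ∣ Nat.card T4 := by
    rw [hprod, hker]
    obtain ⟨c, hc⟩ := h4
    exact ⟨c, by rw [hc]; ring⟩
  exact h64.trans (AddSubgroup.card_addSubgroup_dvd_card T4)

-- (`padicValRat_two_64 : padicValRat 2 64 = 6` is the sibling file C's, p435348.)

end GroupTheory

/-! ## §2 Member-generic consumers for the row type `dim Ш[2] = 4`, `dim (Ш[2] ∩ 2Ш) ≥ 2` -/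

section Consumers

variable {p : ℕ}

/-- **Member-generic LOWER consumer, `[1,3,2]` form.** At an 𝒞_HSY parameter `p`, from
`PublishedFactsTwo` and two DISPLAYED per-curve certificates — `hq : #Ш_an(E_p) = q` with
`ord₂ q ≤ 6`, and `hT : #Ш(E_p)[2] = 16` together with a Klein four-group of `Ш(E_p)[2]` consisting
of doubles (`2`-descent: `dim Sel₂ = 5`, Cassels–Tate rank `2` on `Sel₂`, rank `1`) — the body of
`HeegnerIndexLowerAtTwoHSY` at `p` holds for EVERY global minimal model `W` of `E_p` and EVERY Heegner
frame: `ord₂ 𝔮 = ord₂ q ≤ 6 ≤ ord₂ #Ш(W)` (§1: `64 ∣ #Ш(W)`). CONDITIONAL; EVIDENCE consumer; says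
nothing about other `p`. [cite: HuShuYin2019, Thm. 1.3 and Thm. 1.4 (p. 3)]
[cite: BurungaleFlach2024, Thm. 1.1 and Cor. 2] [cite: Miller2011LMS, §1 and Def. 1.1]
[cite: Cremona1997, §3.6] -/
theorem lower_member_of_twoRankFour_kleinFourHalves_cert
    (hsy : Nat.Prime p ∧ (p % 9 = 4 ∨ p % 9 = 7) ∧ ¬ ∃ x : ZMod p, x ^ 3 = 3)
    (hF : PublishedFactsTwo) {q : ℚ} (hv : padicValRat 2 q ≤ 6)
    (hq : ∀ (W : WeierstrassCurve ℚ) [W.IsElliptic] [W.IsGloballyMinimal],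
      (∃ C : VariableChange ℚ, C • W = cubeSumCurve (p : ℚ)) → shaAn W = (q : ℂ))
    (hT : ∀ (W : WeierstrassCurve ℚ) [W.IsElliptic] [W.IsGloballyMinimal],
      (∃ C : VariableChange ℚ, C • W = cubeSumCurve (p : ℚ)) →
        Nat.card (AddSubgroup.torsionBy W.sha (2 : ℕ)) = 16 ∧
        ∃ x y x' y' : W.sha, (2 : ℤ) • x = 0 ∧ (2 : ℤ) • y = 0 ∧ x ≠ 0 ∧ y ≠ 0 ∧ x ≠ y ∧
          (2 : ℤ) • x' = x ∧ (2 : ℤ) • y' = y) :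
    ∀ (W : WeierstrassCurve ℚ) [W.IsElliptic] [W.IsGloballyMinimal],
      (∃ C : VariableChange ℚ, C • W = cubeSumCurve (p : ℚ)) →
      ∀ (N : ℕ) [NeZero N] (K : Type) [Field K] [NumberField K]
        (Dt : ModularParametrizationData W N) (H : HeegnerDatum N (NumberField.discr K)) (ι : K →+* ℂ)
        (P : (W.baseChange K).toAffine.Point) (Wd : WeierstrassCurve ℚ) [Wd.IsElliptic]
        [Wd.IsGloballyMinimal] (Cd : VariableChange ℚ) (k : ℕ),
        W.HasCM → W.analyticRank = 1 → IsImaginaryQuadratic K → SatisfiesHeegnerHypothesis N K →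
        WeierstrassCurve.Affine.Point.map ι.toRatAlgHom P = heegnerPointComplex Dt H →
        (W.quadraticTwist (NumberField.discr K : ℚ)).entireLFunction 1 ≠ 0 →
        Cd • W.quadraticTwist (NumberField.discr K : ℚ) = Wd → (k = 1 ∨ k = 2) →
        (k = 2 ↔ ∀ y : W.toAffine.Point, ∃ Q : (W.baseChange K).toAffine.Point,
          QuadraticDescent.incl K W y - (2 : ℤ) • Q ∈ AddCommGroup.torsion (W.baseChange K).toAffine.Point) →
        padicValRat 2 (cmHeegnerIndexQuotient W K P Dt.c k Wd Cd.u) ≤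
          padicValNat 2 (Nat.card W.sha) := by
  obtain ⟨hHSY, hBF, hmod, -, -, hGZ, hKo, hGZK, -, -, -⟩ := hF
  obtain ⟨hpr, h9, h3⟩ := hsy
  intro W _ _ hW N _ K _ _ Dt H ι P Wd _ _ Cd k _ _ hK hHN hP hLt hWd hk hkiff
  obtain ⟨h16, x, y, x', y', hx, hy, hx0, hy0, hxy, hx', hy'⟩ := hT W hW
  have hdvd : 2 ^ 6 ∣ Nat.card W.sha := by
    simpa using sixtyfour_dvd_card_of_card_twoTorsion_of_kleinFour_halves h16 hx hy hx0 hy0 hxy hx' hy'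
  exact lower_frame_of_shaAn_of_pow_dvd_card W hHSY hBF hmod hGZK hpr h9 h3 hW (hq W hW) hv hdvd
    N K Dt H ι P (hGZ N W K) (hKo N W K) hK hHN hP hLt Wd Cd hWd hk hkiff

/-- **What `BSD(E_p, 2)` amounts to at such a member**, granted `PublishedFactsTwo` and the same two
displayed certificates with `ord₂ q = 6` exactly: for every global minimal model `W` of `E_p`,
`BSDp W 2 ⟺ ¬ 2⁷ ∣ #Ш(W)` — only `Ш(E_p)[8] = Ш(E_p)[4]` is left (an `8`-descent, or the
Cassels–Tate pairing on `Sel₄`). CONDITIONAL; EVIDENCE consumer. [cite: Miller2011LMS, §1 and Def. 1.1]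
[cite: HuShuYin2019, Thm. 1.3 and Thm. 1.4 (p. 3)] [cite: BurungaleFlach2024, Thm. 1.1 and Cor. 2] -/
theorem bsdTwo_member_iff_not_128_dvd_of_cert
    (hsy : Nat.Prime p ∧ (p % 9 = 4 ∨ p % 9 = 7) ∧ ¬ ∃ x : ZMod p, x ^ 3 = 3)
    (hF : PublishedFactsTwo) {q : ℚ} (hv : padicValRat 2 q = 6)
    (hq : ∀ (W : WeierstrassCurve ℚ) [W.IsElliptic] [W.IsGloballyMinimal],
      (∃ C : VariableChange ℚ, C • W = cubeSumCurve (p : ℚ)) → shaAn W = (q : ℂ))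
    (hT : ∀ (W : WeierstrassCurve ℚ) [W.IsElliptic] [W.IsGloballyMinimal],
      (∃ C : VariableChange ℚ, C • W = cubeSumCurve (p : ℚ)) →
        Nat.card (AddSubgroup.torsionBy W.sha (2 : ℕ)) = 16 ∧
        ∃ x y x' y' : W.sha, (2 : ℤ) • x = 0 ∧ (2 : ℤ) • y = 0 ∧ x ≠ 0 ∧ y ≠ 0 ∧ x ≠ y ∧
          (2 : ℤ) • x' = x ∧ (2 : ℤ) • y' = y)
    (W : WeierstrassCurve ℚ) [W.IsElliptic] [W.IsGloballyMinimal]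
    (hW : ∃ C : VariableChange ℚ, C • W = cubeSumCurve (p : ℚ)) :
    BSDp W 2 ↔ ¬ 2 ^ 7 ∣ Nat.card W.sha := by
  haveI : Fact (Nat.Prime 2) := ⟨Nat.prime_two⟩
  obtain ⟨hHSY, hBF, hmod, -, -, -, -, hGZK, -, -, -⟩ := hF
  obtain ⟨hpr, h9, h3⟩ := hsy
  obtain ⟨hr, hfin, -⟩ :=
    Summit.BirchSwinnertonDyer.Rank1Residual.X12.CubeSumFamilies.bsdp_three_of_thm14' hHSY hBF hmod hpr h9 h3 W hW
  haveI := hfin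
  have hq' : shaAn W = (q : ℂ) := hq W hW
  obtain ⟨h16, x, y, x', y', hx, hy, hx0, hy0, hxy, hx', hy'⟩ := hT W hW
  have h64 : 2 ^ 6 ∣ Nat.card W.sha := by
    simpa using sixtyfour_dvd_card_of_card_twoTorsion_of_kleinFour_halves h16 hx hy hx0 hy0 hxy hx' hy'
  have hcard : Nat.card W.sha ≠ 0 := (Nat.card_pos (α := W.sha)).ne'
  have hrank : W.mordellWeilRank = W.analyticRank := (hGZK W (by rw [hr])).1
  have hprim : padicValNat 2 (Nat.card (AddCommGroup.primaryComponent W.sha 2)) =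
      padicValNat 2 (Nat.card W.sha) := padicValNat_card_addPrimaryComponent 2
  have h6 : 6 ≤ padicValNat 2 (Nat.card W.sha) := (padicValNat_dvd_iff_le hcard).mp h64
  constructor
  · rintro ⟨-, -, q', hqq, hvq⟩ h128
    have hqq' : q' = q := by exact_mod_cast hqq.symm.trans hq'
    rw [hqq', hv, hprim] at hvq
    have h7 : 7 ≤ padicValNat 2 (Nat.card W.sha) := (padicValNat_dvd_iff_le hcard).mp h128
    omega
  · intro h128
    have hlt : padicValNat 2 (Nat.card W.sha) < 7 := by
      by_contra hge
      exact h128 ((padicValNat_dvd_iff_le hcard).mpr (not_lt.mp hge))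
    refine ⟨hrank, Finite.of_injective _ Subtype.val_injective, q, hq', ?_⟩
    rw [hv, hprim]
    have : padicValNat 2 (Nat.card W.sha) = 6 := by omega
    exact_mod_cast this.symm

end Consumers

/-! ## §3 The member `p = 831631` (`ellrank` type `[1, 3, 2]`; seat g7, kit j269192 / j269295 / j269511)

Reading key (HYPOTHESES, not kernel facts). `hq : #Ш_an(E_{831631}) = 64`: PARI 2.17 `ellL1`/`ellbsd`/
`ellheight` at 28 digits on `[0,0,p,0,−7p²]`, generator `G` = the effort-2 `ellrank` point
`(5821417/256, 9203660277/4096)` saturated at primes `≤ 500` (`[P:G]² = 1`), `L′(E,1) = 24.925206981…`,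
`∏c_v = 3`, `ĥ(G) = 6.9103495…`, `L′/(Ω·∏c_v·ĥ) = 64.000…` (one engine — «numerically exact, NOT
certified»). `hT`: `ellrank = [1, 3, 2]` at efforts 0/1/2 (`dim Sel₂ = 5`; Cassels–Tate rank `2` on
`Sel₂`: a `2`-dimensional subspace of `Ш[2]` is detected by the pairing and its `2`-dimensional
orthogonal inside `Ш[2]` lies in the kernel `Ш[2] ∩ 2Ш`) on the `bnfcertify`'d cubic field
`ℚ(∛(4·831631))` (`Cl ≅ [12,6,2,2]`, `k = 4`; THEOREM A gives `dim Sel₂ = 5` independently); with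
`rank E_{831631}(ℚ) = 1`: `#Ш[2] = 16` and a Klein four of doubles. BSD₂ then predicts
`Ш(E_{831631})[2^∞] ≅ (ℤ/4)² ⊕ (ℤ/2)²` (`Ш[8] = Ш[4]`), undecided here.
-/

/-- `831631` is an 𝒞_HSY parameter: prime, `831631 ≡ 4 (mod 9)`, `3` not a cube mod it (Euler).
[cite: HuShuYin2019, Thm. 1.4 (p. 3)] -/
theorem hsy_831631 :
    Nat.Prime 831631 ∧ (831631 % 9 = 4 ∨ 831631 % 9 = 7) ∧ ¬ ∃ x : ZMod 831631, x ^ 3 = 3 :=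
  hsy_of_pow_mod_ne_one (by norm_num) (Or.inl rfl) (by decide +kernel)

/-- **The LOWER crux `HeegnerIndexLowerAtTwoHSY` at `p = 831631`** (body verbatim, `p := 831631`), from
`PublishedFactsTwo` + the two DISPLAYED certificates of the §3 header (`hq : #Ш_an = 64`, kit j269511;
`hT : #Ш[2] = 16` with a Klein four of doubles, kit j269295): `ord₂ 𝔮 = 6 ≤ ord₂ #Ш(W)` in every frame.
CONDITIONAL; EVIDENCE consumer. [cite: HuShuYin2019, Thm. 1.3 and Thm. 1.4 (p. 3)]
[cite: Miller2011LMS, §1 and Def. 1.1] [cite: BurungaleFlach2024, Thm. 1.1 and Cor. 2] -/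
theorem sylvesterTwoHeegnerIndex_heegnerIndexLowerAtTwoHSY_831631 (hF : PublishedFactsTwo)
    (hq : ∀ (W : WeierstrassCurve ℚ) [W.IsElliptic] [W.IsGloballyMinimal],
      (∃ C : VariableChange ℚ, C • W = cubeSumCurve ((831631 : ℕ) : ℚ)) → shaAn W = ((64 : ℚ) : ℂ))
    (hT : ∀ (W : WeierstrassCurve ℚ) [W.IsElliptic] [W.IsGloballyMinimal],
      (∃ C : VariableChange ℚ, C • W = cubeSumCurve ((831631 : ℕ) : ℚ)) →
        Nat.card (AddSubgroup.torsionBy W.sha (2 : ℕ)) = 16 ∧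
        ∃ x y x' y' : W.sha, (2 : ℤ) • x = 0 ∧ (2 : ℤ) • y = 0 ∧ x ≠ 0 ∧ y ≠ 0 ∧ x ≠ y ∧
          (2 : ℤ) • x' = x ∧ (2 : ℤ) • y' = y) :
    ∀ (W : WeierstrassCurve ℚ) [W.IsElliptic] [W.IsGloballyMinimal],
      (∃ C : VariableChange ℚ, C • W = cubeSumCurve ((831631 : ℕ) : ℚ)) →
      ∀ (N : ℕ) [NeZero N] (K : Type) [Field K] [NumberField K]
        (Dt : ModularParametrizationData W N) (H : HeegnerDatum N (NumberField.discr K)) (ι : K →+* ℂ)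
        (P : (W.baseChange K).toAffine.Point) (Wd : WeierstrassCurve ℚ) [Wd.IsElliptic]
        [Wd.IsGloballyMinimal] (Cd : VariableChange ℚ) (k : ℕ),
        W.HasCM → W.analyticRank = 1 → IsImaginaryQuadratic K → SatisfiesHeegnerHypothesis N K →
        WeierstrassCurve.Affine.Point.map ι.toRatAlgHom P = heegnerPointComplex Dt H →
        (W.quadraticTwist (NumberField.discr K : ℚ)).entireLFunction 1 ≠ 0 →
        Cd • W.quadraticTwist (NumberField.discr K : ℚ) = Wd → (k = 1 ∨ k = 2) →
        (k = 2 ↔ ∀ y : W.toAffine.Point, ∃ Q : (W.baseChange K).toAffine.Point,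
          QuadraticDescent.incl K W y - (2 : ℤ) • Q ∈ AddCommGroup.torsion (W.baseChange K).toAffine.Point) →
        padicValRat 2 (cmHeegnerIndexQuotient W K P Dt.c k Wd Cd.u) ≤
          padicValNat 2 (Nat.card W.sha) :=
  lower_member_of_twoRankFour_kleinFourHalves_cert hsy_831631 hF (le_of_eq padicValRat_two_64) hq hT

/-- **What `BSD(E_{831631}, 2)` amounts to**, granted `PublishedFactsTwo` and the same displayed
certificates: for every global minimal model `W`, `BSDp W 2 ⟺ ¬ 128 ∣ #Ш(W)` (i.e. `Ш[8] = Ш[4]`; an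
`8`-descent). CONDITIONAL; EVIDENCE consumer. [cite: Miller2011LMS, §1 and Def. 1.1]
[cite: HuShuYin2019, Thm. 1.3 and Thm. 1.4 (p. 3)] -/
theorem sylvesterTwoHeegnerIndex_bsdTwo_iff_not_128_dvd_831631 (hF : PublishedFactsTwo)
    (hq : ∀ (W : WeierstrassCurve ℚ) [W.IsElliptic] [W.IsGloballyMinimal],
      (∃ C : VariableChange ℚ, C • W = cubeSumCurve ((831631 : ℕ) : ℚ)) → shaAn W = ((64 : ℚ) : ℂ))
    (hT : ∀ (W : WeierstrassCurve ℚ) [W.IsElliptic] [W.IsGloballyMinimal],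
      (∃ C : VariableChange ℚ, C • W = cubeSumCurve ((831631 : ℕ) : ℚ)) →
        Nat.card (AddSubgroup.torsionBy W.sha (2 : ℕ)) = 16 ∧
        ∃ x y x' y' : W.sha, (2 : ℤ) • x = 0 ∧ (2 : ℤ) • y = 0 ∧ x ≠ 0 ∧ y ≠ 0 ∧ x ≠ y ∧
          (2 : ℤ) • x' = x ∧ (2 : ℤ) • y' = y)
    (W : WeierstrassCurve ℚ) [W.IsElliptic] [W.IsGloballyMinimal]
    (hW : ∃ C : VariableChange ℚ, C • W = cubeSumCurve ((831631 : ℕ) : ℚ)) :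
    BSDp W 2 ↔ ¬ 2 ^ 7 ∣ Nat.card W.sha :=
  bsdTwo_member_iff_not_128_dvd_of_cert hsy_831631 hF padicValRat_two_64 hq hT W hW

end SylvesterTwoLowerCert

end Summit.BirchSwinnertonDyer.BirchSwinnertonDyer.Theorems

end
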